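import Summits.CriticalPhenomena.PercolationContinuityZ3.Theorems.Transplant.FKDoubleFanWordCellsParts
import HarnessLib

/-!
# Double fans `K₂ ∨ P_{m+1}`, cells of a two-block middle pattern: the polarized cells of the words containing a `W_D` letter FACTOR
# through one-sided forms

Helper file (`--supports stmt-CriticalPhenomena-4575`), FK sub-lane `prim-bschramm-fk-3` (gen 49); builds on p205010 (kernel theorem, internal
audit signed; external expert review pending).  Pure real algebra; no named facts, no sorries; standard axioms.  Memo
`bschramm/prim-bschramm-fk-3/FAR-CROSS-XXIV.md` §2.

Of the 27 rim words `κ = (k0,k1,k2) ∈ {W_D, T_D, I}³` of a two-block pattern, the 19 containing the rank-one letter `W_D = ℓ_D ⊗ (a∧b)`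
(`opWD_eq_smul`) have polarized cells that are PRODUCTS of one-sided factors:
* `W_D` first (`…WordCellsRimSplit`, `pcell2_zero_first`): `nform q P ×` (the rest of the word applied to `a∧b`, paired with the target);
* `W_D` last (**`pcell2_zero_last`**, by self-adjointness `pairH_opWD` and **`formD_targetBiv`**: `ℓ_D(targetBiv S) = nform q S`):
  `nform q S ×` (the word before the last rim applied to the input, paired with `a∧b`);
* `W_D` in the middle (**`pcell2_zero_mid`**): `ℓ_D(first block of the input) ×` (last block of `a∧b` paired with the target).
The master form `nform` is `≥ 0` at each of the seven generators (**`nform_nonneg_of_isGenP`**: values `0, 1, 1−q, 1, 0, (2−q)w², q(2−q)w²`, so for `0 ≤ q ≤ 1`).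
So the parts condition `PartsOK` of these 19 words reduces to sign conditions on one-sided polynomials in at most three variables besides `q`
(for the MIN pattern: 133 tiny tensor-Bernstein certificates, uniform in `q ∈ [0,1]`, files `…D3MinW*`).
[folklore]
-/

noncomputable section

namespace Summit.CriticalPhenomena.PercolationContinuityZ3.Theorems

namespace FK

namespace ThreeApex

/-! ### The target form -/

/-- On target bivectors the linear form `ℓ_D` is the `N`-form of the target product vector: `ℓ_D(targetBiv S) = nform q S`. [folklore] -/
theorem formD_targetBiv (q : ℝ) (S : P6) : formD q (targetBiv S) = nform q S := by
  simp only [formD, targetBiv, nform]; ring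

/-! ### `W_D` last and `W_D` in the middle -/

/-- The rim letter `0` is `W_D`. [folklore] -/
theorem rimOp_zero (q : ℝ) (β : Biv) : rimOp q 0 β = opWD q β := rfl

/-- **`W_D` at the last rim**: `pcell2 q k0 k1 0 … P S = nform q S · ⟪(two blocks)·R_{k0}(inputBiv P), a∧b⟫`. [folklore] -/
theorem pcell2_zero_last (q : ℝ) (k0 k1 : ℕ) (x1 y1 x2 y2 : ℝ) (P S : P6) :
    pcell2 q k0 k1 0 x1 y1 x2 y2 P S =
      nform q S * pairH q (opAC x2 (opBC y2 (rimOp q k1 (opAC x1 (opBC y1 (rimOp q k0 (inputBiv P))))))) bivAB := by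
  simp only [pcell2, rimOp_zero]
  rw [pairH_opWD, opWD_eq_smul, formD_targetBiv, pairH_comm, pairH_smul_left, pairH_comm]

/-- **`W_D` at the middle rim**: `pcell2 q k0 0 k2 … P S = ℓ_D(∧²AC_{x1}∧²BC_{y1} R_{k0}(inputBiv P)) · ⟪R_{k2} ∧²AC_{x2}∧²BC_{y2}(a∧b), targetBiv S⟫`.
[folklore] -/
theorem pcell2_zero_mid (q : ℝ) (k0 k2 : ℕ) (x1 y1 x2 y2 : ℝ) (P S : P6) :
    pcell2 q k0 0 k2 x1 y1 x2 y2 P S =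
      formD q (opAC x1 (opBC y1 (rimOp q k0 (inputBiv P)))) * pairH q (rimOp q k2 (opAC x2 (opBC y2 bivAB))) (targetBiv S) := by
  simp only [pcell2, rimOp_zero]
  rw [opWD_eq_smul, opBC_smul', opAC_smul, rimOp_smul, pairH_smul_left]

/-! ### The master form at the generators -/

/-- `nform` at the ray `A` vanishes. [folklore] -/
theorem nform_rayA (q : ℝ) : nform q rayA = 0 := by simp [nform, rayA]
/-- `nform` at the ray `D` is `1`. [folklore] -/
theorem nform_rayD (q : ℝ) : nform q rayD = 1 := by simp [nform, rayD]
/-- `nform` at the ray `AC` is `1 − q`. [folklore] -/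
theorem nform_rayAC (q : ℝ) : nform q rayAC = 1 - q := by simp [nform, rayAC]
/-- `nform` at the ray `BD` is `1`. [folklore] -/
theorem nform_rayBD (q : ℝ) : nform q rayBD = 1 := by simp [nform, rayBD]
/-- `nform` at `𝟙` vanishes. [folklore] -/
theorem nform_rayOne (q : ℝ) : nform q rayOne = 0 := by simp only [nform, rayOne]; ring
/-- `nform` at the roof part `R₀(w)` is `(2−q)w²`. [folklore] -/
theorem nform_roofR0 (q w : ℝ) : nform q (roofR0 q w) = (2 - q) * w ^ 2 := by simp only [nform, roofR0, xwR, zwR]; ring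
/-- `nform` at the roof part `R₁(w)` is `q(2−q)w²`. [folklore] -/
theorem nform_roofR1 (q w : ℝ) : nform q (roofR1 q w) = q * (2 - q) * w ^ 2 := by simp only [nform, roofR1, xwR, zwR]; ring

/-- **The master form is non-negative at every generator** (`0 ≤ q ≤ 1`). [folklore] -/
theorem nform_nonneg_of_isGenP {q : ℝ} (hq0 : 0 ≤ q) (hq1 : q ≤ 1) {P : P6} (hP : IsGenP q P) : 0 ≤ nform q P := by
  have h2 : 0 ≤ 2 - q := by linarith
  rcases hP with rfl | rfl | rfl | rfl | rfl | ⟨w, _, _, rfl | rfl⟩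
  · rw [nform_rayA]
  · rw [nform_rayD]; exact zero_le_one
  · rw [nform_rayAC]; linarith
  · rw [nform_rayBD]; exact zero_le_one
  · rw [nform_rayOne]
  · rw [nform_roofR0]; positivity
  · rw [nform_roofR1]; positivity

/-! ### Parts of the `W_D`-words from one-sided signs -/

section WParts

variable {q : ℝ} {k0 k1 k2 : ℕ} {x1 y1 x2 y2 : ℝ}

/-- **`W_D` first**: if the target-side factor is `≥ 0` at every generator, the word `(0,k1,k2)` satisfies its parts condition (`0 ≤ q ≤ 1`).
[folklore] -/
theorem partsOK_zero_first (hq0 : 0 ≤ q) (hq1 : q ≤ 1)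
    (hS : ∀ S : P6, IsGenP q S → 0 ≤ pairH q (rimOp q k2 (opAC x2 (opBC y2 (rimOp q k1 (opAC x1 (opBC y1 bivAB)))))) (targetBiv S)) :
    PartsOK q 0 k1 k2 x1 y1 x2 y2 := by
  intro P S hP hS'
  rw [pcell2_zero_first]
  exact mul_nonneg (nform_nonneg_of_isGenP hq0 hq1 hP) (hS S hS')

/-- **`W_D` last**: if the input-side factor is `≥ 0` at every generator, the word `(k0,k1,0)` satisfies its parts condition. [folklore] -/
theorem partsOK_zero_last (hq0 : 0 ≤ q) (hq1 : q ≤ 1)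
    (hP : ∀ P : P6, IsGenP q P → 0 ≤ pairH q (opAC x2 (opBC y2 (rimOp q k1 (opAC x1 (opBC y1 (rimOp q k0 (inputBiv P))))))) bivAB) :
    PartsOK q k0 k1 0 x1 y1 x2 y2 := by
  intro P S hP' hS
  rw [pcell2_zero_last]
  exact mul_nonneg (nform_nonneg_of_isGenP hq0 hq1 hS) (hP P hP')

/-- **`W_D` in the middle**: if both one-sided factors are `≥ 0` at every generator, the word `(k0,0,k2)` satisfies its parts condition.
[folklore] -/
theorem partsOK_zero_mid
    (hP : ∀ P : P6, IsGenP q P → 0 ≤ formD q (opAC x1 (opBC y1 (rimOp q k0 (inputBiv P)))))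
    (hS : ∀ S : P6, IsGenP q S → 0 ≤ pairH q (rimOp q k2 (opAC x2 (opBC y2 bivAB))) (targetBiv S)) :
    PartsOK q k0 0 k2 x1 y1 x2 y2 := by
  intro P S hP' hS'
  rw [pcell2_zero_mid]
  exact mul_nonneg (hP P hP') (hS S hS')

end WParts

end ThreeApex

end FK

end Summit.CriticalPhenomena.PercolationContinuityZ3.Theorems
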